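import Literature.NumberTheory.Weil1964.UnitaryArchSingularCentralizerTopFormHaarCoherence   -- ★ B2d: frames under conjugation, `centralizerTopFormHaar_eq_centralizerMeasureOfFrame`
import Literature.NumberTheory.Automorphic.UnitaryGroupFormCongrFinSum                      -- ★ `formCongr_mul_eq`
import HarnessLib

/-!
# The top-form centraliser measure is transported by form congruences: `(S · S⁻¹)_* centralizerTopFormHaar H₂ γ = centralizerTopFormHaar H (S γ S⁻¹)` for `σ(S)ᵀ H′ S = H₂′`
# («(b0)», Rogawski 1990 §1.7 p. 6 «compatible measures `dg′ = |ψ^*Ω|`», §3.8 Prop. 3.8.1 (a))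

Topic `NumberTheory/Weil1964` (the D-T road's measure bricks); namespace `Literature.NumberTheory.Weil1964.UnitaryArchTopForm`.  THEOREMS ONLY (no definition, no instance, no
notation, no named fact, no `sorry`).  Cell `pub/hodgecm-mathlib`, crux H413 = `stmt-HodgeConjecture-24833` (supports-only); LEAD F0P3a-plan (g10) WORD T9-22 (3) «(W-b) + (b0)»:
the brick that moves the universal (J-val-K) hypothesis (U) (★ F0P3-p03 `ArchSingularPinTopFormUniversal`) from the diagonal carrier `U(diag α′)(L⁺ ⊗ ℝ)` to `U(H′)(L⁺ ⊗ ℝ)`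
along the congruence `Ψ = unitaryGroupOfFormCongrOfEq … S …` (as ★ B1 `map_archCongr_archTopFormHaar` does for the group measure).  Author F0P3-p03 (g10) on A-p19's B2 chain.
Count-neutral.  HONEST LABEL: HC_CM is proved only modulo the printed citations until rung 0 closes; this file pays nothing by itself.

* `IsSingularArchFrame.of_formCongr` — a frame `(a, b, T₂, H_a, H_b)` of `γ₂ ∈ U(H₂)(L⁺ ⊗ ℝ)` and a congruence `σ(S)ᵀ H′ S = H₂′` give the frame `(a, b, S T₂, H_a, H_b)` of
  `S γ₂ S⁻¹ ∈ U(H)(L⁺ ⊗ ℝ)` (★ `formCongr_mul_eq`; cf. ★ `IsSingularArchFrame.conj_of_formCongr_eq` for form-PRESERVING `g`).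
* `exists_isSingularArchFrame_archCongr` — framed points go to framed points.
* **`map_archCongr_centralizerTopFormHaar`** — for framed `γ₂`, the congruence homeomorphism `Z(γ₂) ≃ₜ Z(S γ₂ S⁻¹)` (★ `subgroupCongrHomeomorph`) carries
  `centralizerTopFormHaar L H₂ γ₂` to `centralizerTopFormHaar L H (S γ₂ S⁻¹)`: both are frame push-forwards of the SAME block measure `archTopFormHaar H_a ⊗ archTopFormHaar H_b`
  (frame independence ★ `centralizerTopFormHaar_eq_centralizerMeasureOfFrame`), and `S (T₂ u T₂⁻¹) S⁻¹ = (S T₂) u (S T₂)⁻¹`.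

## References
* [Rogawski1990] J. D. Rogawski, *Automorphic Representations of Unitary Groups in Three Variables*, Ann. of Math. Stud. 123 (1990), §1.7 p. 6; §3.8 Prop. 3.8.1 (a) p. 27.
* [PlatonovRapinchuk1994] V. Platonov, A. Rapinchuk, *Algebraic Groups and Number Theory* (1994), §2.3 (congruent forms, conjugate unitary groups).
-/

set_option autoImplicit false

noncomputable section

open NumberField NumberField.mixedEmbedding NumberField.InfinitePlace Set MeasureTheory MeasureTheory.Measure
open Literature.NumberTheory.Automorphic Literature.NumberTheory.Automorphic.UnitaryGroup Literature.NumberTheory.Rogawski1990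
open Literature.MeasureTheory.Group
open scoped Classical Matrix MatrixGroups ENNReal NNReal

namespace Literature.NumberTheory.Weil1964

namespace UnitaryArchTopForm

section Congr

variable {L : Type} [Field L] [NumberField L] [IsCMField L] {H H₂ : Matrix (Fin 3) (Fin 3) L}

/-- **Frames transport along a form congruence**: if `(a, b, T₂, H_a, H_b)` is a frame of `γ₂ ∈ U(H₂)(L⁺ ⊗ ℝ)` and `σ(S)ᵀ H′ S = H₂′`, then `(a, b, S T₂, H_a, H_b)` is a
frame of `S γ₂ S⁻¹ ∈ U(H)(L⁺ ⊗ ℝ)`. [cite: Rogawski1990, §3.8 Prop. 3.8.1 (a) p. 27] [cite: PlatonovRapinchuk1994, §2.3] -/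
theorem IsSingularArchFrame.of_formCongr {γ₂ : arch (↥(maximalRealSubfield L)) L (IsCMField.complexConj L) 3 H₂} {a b : L} {T₂ : GL (Fin 3) (mixedSpace L)}
    {H_a : Matrix (Fin 2) (Fin 2) L} {H_b : Matrix (Fin 1) (Fin 1) L} (h : IsSingularArchFrame L H₂ γ₂ a b T₂ H_a H_b)
    (S : GL (Fin 3) (mixedSpace L))
    (hS : formCongr (conjMixed (↥(maximalRealSubfield L)) L (IsCMField.complexConj L)) S (archFormOf L 3 H) = archFormOf L 3 H₂) :
    IsSingularArchFrame L H
      (unitaryGroupOfFormCongrOfEq (conjMixed (↥(maximalRealSubfield L)) L (IsCMField.complexConj L)) S (archFormOf L 3 H) (archFormOf L 3 H₂) hS γ₂)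
      a b (S * T₂) H_a H_b := by
  refine ⟨h.1, h.2.1, h.2.2.1, h.2.2.2.1, h.2.2.2.2.1, ?_, ?_⟩
  · rw [formCongr_mul_eq, hS, h.formCongr_eq]
  · have hGL : ((unitaryGroupOfFormCongrOfEq (conjMixed (↥(maximalRealSubfield L)) L (IsCMField.complexConj L)) S (archFormOf L 3 H) (archFormOf L 3 H₂) hS γ₂ :
          arch (↥(maximalRealSubfield L)) L (IsCMField.complexConj L) 3 H) : GL (Fin 3) (mixedSpace L)) * (S * T₂) =
        S * ((γ₂ : GL (Fin 3) (mixedSpace L)) * T₂) := by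
      rw [coe_unitaryGroupOfFormCongrOfEq_apply]
      simp only [mul_assoc, inv_mul_cancel_left]
    have hM := congrArg (fun g : GL (Fin 3) (mixedSpace L) => (g : Matrix (Fin 3) (Fin 3) (mixedSpace L))) hGL
    simp only [Units.val_mul] at hM
    rw [Units.val_mul, hM, h.mul_eq, Matrix.mul_assoc]

/-- Framed points go to framed points under a form congruence. [cite: Rogawski1990, §3.8 Prop. 3.8.1 (a) p. 27] -/
theorem exists_isSingularArchFrame_archCongr (S : GL (Fin 3) (mixedSpace L))
    (hS : formCongr (conjMixed (↥(maximalRealSubfield L)) L (IsCMField.complexConj L)) S (archFormOf L 3 H) = archFormOf L 3 H₂)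
    (γ₂ : arch (↥(maximalRealSubfield L)) L (IsCMField.complexConj L) 3 H₂)
    (hγ₂ : ∃ (a b : L) (T : GL (Fin 3) (mixedSpace L)) (H_a : Matrix (Fin 2) (Fin 2) L) (H_b : Matrix (Fin 1) (Fin 1) L), IsSingularArchFrame L H₂ γ₂ a b T H_a H_b) :
    ∃ (a b : L) (T : GL (Fin 3) (mixedSpace L)) (H_a : Matrix (Fin 2) (Fin 2) L) (H_b : Matrix (Fin 1) (Fin 1) L),
      IsSingularArchFrame L H
        (unitaryGroupOfFormCongrOfEq (conjMixed (↥(maximalRealSubfield L)) L (IsCMField.complexConj L)) S (archFormOf L 3 H) (archFormOf L 3 H₂) hS γ₂) a b T H_a H_b := by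
  obtain ⟨a, b, T, Ha, Hb, hf⟩ := hγ₂
  exact ⟨a, b, _, Ha, Hb, hf.of_formCongr S hS⟩

variable [MeasurableSpace (arch (↥(maximalRealSubfield L)) L (IsCMField.complexConj L) 3 H)] [BorelSpace (arch (↥(maximalRealSubfield L)) L (IsCMField.complexConj L) 3 H)]
  [MeasurableSpace (arch (↥(maximalRealSubfield L)) L (IsCMField.complexConj L) 3 H₂)] [BorelSpace (arch (↥(maximalRealSubfield L)) L (IsCMField.complexConj L) 3 H₂)]

/-- **(b0) THE TOP-FORM CENTRALISER MEASURE IS TRANSPORTED BY FORM CONGRUENCES.**  For a congruence `σ(S)ᵀ H′ S = H₂′` (`Ψ : U(H₂)(L⁺ ⊗ ℝ) ≃ₜ* U(H)(L⁺ ⊗ ℝ)`, `g ↦ S g S⁻¹`,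
★ `unitaryGroupOfFormCongrOfEq`) and a framed `γ₂ ∈ U(H₂)(L⁺ ⊗ ℝ)`, the restriction `Z(γ₂) ≃ₜ Z(Ψ γ₂)` carries `centralizerTopFormHaar L H₂ γ₂` to
`centralizerTopFormHaar L H (Ψ γ₂)`: print's «compatible measures `dg′ = |ψ^*Ω|`» at the singular centralisers.  (Both sides are the push-forward of the block top-form
measure `archTopFormHaar H_a ⊗ archTopFormHaar H_b` through the frames `T₂` and `S T₂`; frame independence ★ `centralizerTopFormHaar_eq_centralizerMeasureOfFrame`.)
[cite: Rogawski1990, §1.7 p. 6; §3.8 Prop. 3.8.1 (a) p. 27] [cite: PlatonovRapinchuk1994, §2.3] -/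
theorem map_archCongr_centralizerTopFormHaar (S : GL (Fin 3) (mixedSpace L))
    (hS : formCongr (conjMixed (↥(maximalRealSubfield L)) L (IsCMField.complexConj L)) S (archFormOf L 3 H) = archFormOf L 3 H₂)
    {γ₂ : arch (↥(maximalRealSubfield L)) L (IsCMField.complexConj L) 3 H₂}
    (hγ₂ : ∃ (a b : L) (T : GL (Fin 3) (mixedSpace L)) (H_a : Matrix (Fin 2) (Fin 2) L) (H_b : Matrix (Fin 1) (Fin 1) L), IsSingularArchFrame L H₂ γ₂ a b T H_a H_b) :
    Measure.map (α := ↥(Subgroup.centralizer ({γ₂} : Set (arch (↥(maximalRealSubfield L)) L (IsCMField.complexConj L) 3 H₂)))) (β := ↥(Subgroup.centralizer ({(unitaryGroupOfFormCongrOfEq (conjMixed (↥(maximalRealSubfield L)) L (IsCMField.complexConj L)) S (archFormOf L 3 H) (archFormOf L 3 H₂) hS) γ₂} : Set (arch (↥(maximalRealSubfield L)) L (IsCMField.complexConj L) 3 H))))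
      (subgroupCongrHomeomorph
        ((unitaryGroupOfFormCongrOfEq (conjMixed (↥(maximalRealSubfield L)) L (IsCMField.complexConj L)) S (archFormOf L 3 H) (archFormOf L 3 H₂) hS).toMulEquiv : arch (↥(maximalRealSubfield L)) L (IsCMField.complexConj L) 3 H₂ ≃* arch (↥(maximalRealSubfield L)) L (IsCMField.complexConj L) 3 H)
        (Subgroup.centralizer ({γ₂} : Set (arch (↥(maximalRealSubfield L)) L (IsCMField.complexConj L) 3 H₂)))
        (Subgroup.centralizer ({unitaryGroupOfFormCongrOfEq (conjMixed (↥(maximalRealSubfield L)) L (IsCMField.complexConj L)) S (archFormOf L 3 H) (archFormOf L 3 H₂) hS γ₂} :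
          Set (arch (↥(maximalRealSubfield L)) L (IsCMField.complexConj L) 3 H)))
        (forall_apply_mem_centralizer_singleton_iff_of_eq
          ((unitaryGroupOfFormCongrOfEq (conjMixed (↥(maximalRealSubfield L)) L (IsCMField.complexConj L)) S (archFormOf L 3 H) (archFormOf L 3 H₂) hS).toMulEquiv : arch (↥(maximalRealSubfield L)) L (IsCMField.complexConj L) 3 H₂ ≃* arch (↥(maximalRealSubfield L)) L (IsCMField.complexConj L) 3 H) rfl)
        (unitaryGroupOfFormCongrOfEq (conjMixed (↥(maximalRealSubfield L)) L (IsCMField.complexConj L)) S (archFormOf L 3 H) (archFormOf L 3 H₂) hS).continuous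
        (unitaryGroupOfFormCongrOfEq (conjMixed (↥(maximalRealSubfield L)) L (IsCMField.complexConj L)) S (archFormOf L 3 H) (archFormOf L 3 H₂) hS).symm.continuous)
      (centralizerTopFormHaar L H₂ γ₂) =
    centralizerTopFormHaar L H
      (unitaryGroupOfFormCongrOfEq (conjMixed (↥(maximalRealSubfield L)) L (IsCMField.complexConj L)) S (archFormOf L 3 H) (archFormOf L 3 H₂) hS γ₂) := by
  obtain ⟨a, b, T, Ha, Hb, h₂⟩ := hγ₂
  have h₁ := h₂.of_formCongr S hS
  letI : MeasurableSpace (arch (↥(maximalRealSubfield L)) L (IsCMField.complexConj L) 2 Ha) := borel _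
  haveI : BorelSpace (arch (↥(maximalRealSubfield L)) L (IsCMField.complexConj L) 2 Ha) := ⟨rfl⟩
  letI : MeasurableSpace (archSkew (↥(maximalRealSubfield L)) L (IsCMField.complexConj L) 2 Ha) := borel _
  haveI : BorelSpace (archSkew (↥(maximalRealSubfield L)) L (IsCMField.complexConj L) 2 Ha) := ⟨rfl⟩
  letI : MeasurableSpace (arch (↥(maximalRealSubfield L)) L (IsCMField.complexConj L) 1 Hb) := borel _
  haveI : BorelSpace (arch (↥(maximalRealSubfield L)) L (IsCMField.complexConj L) 1 Hb) := ⟨rfl⟩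
  letI : MeasurableSpace (archSkew (↥(maximalRealSubfield L)) L (IsCMField.complexConj L) 1 Hb) := borel _
  haveI : BorelSpace (archSkew (↥(maximalRealSubfield L)) L (IsCMField.complexConj L) 1 Hb) := ⟨rfl⟩
  haveI : BorelSpace (arch (↥(maximalRealSubfield L)) L (IsCMField.complexConj L) 2 Ha × arch (↥(maximalRealSubfield L)) L (IsCMField.complexConj L) 1 Hb) :=
    Prod.borelSpace
  rw [centralizerTopFormHaar_eq_centralizerMeasureOfFrame h₂, centralizerTopFormHaar_eq_centralizerMeasureOfFrame h₁, centralizerMeasureOfFrame_def,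
    centralizerMeasureOfFrame_def]
  have hmeas₂ : Measurable (fun u : arch (↥(maximalRealSubfield L)) L (IsCMField.complexConj L) 2 Ha × arch (↥(maximalRealSubfield L)) L (IsCMField.complexConj L) 1 Hb =>
      (⟨archFrameEmbedding (N₁ := 2) (N₂ := 1) T h₂.formCongr_eq u, archFrameEmbedding_mem_centralizer (N₁ := 2) (N₂ := 1) T h₂.formCongr_eq γ₂ h₂.mul_eq u⟩ :
        Subgroup.centralizer ({γ₂} : Set (arch (↥(maximalRealSubfield L)) L (IsCMField.complexConj L) 3 H₂)))) :=
    ((continuous_archFrameEmbedding (N₁ := 2) (N₂ := 1) T h₂.formCongr_eq).subtype_mk _).measurable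
  haveI iB2 : BorelSpace (↥(Subgroup.centralizer ({γ₂} : Set (arch (↥(maximalRealSubfield L)) L (IsCMField.complexConj L) 3 H₂)))) := Subtype.borelSpace _
  haveI iO2 : OpensMeasurableSpace (↥(Subgroup.centralizer ({γ₂} : Set (arch (↥(maximalRealSubfield L)) L (IsCMField.complexConj L) 3 H₂)))) := iB2.opensMeasurable
  haveI iB1 : BorelSpace (↥(Subgroup.centralizer ({(unitaryGroupOfFormCongrOfEq (conjMixed (↥(maximalRealSubfield L)) L (IsCMField.complexConj L)) S (archFormOf L 3 H) (archFormOf L 3 H₂) hS) γ₂} : Set (arch (↥(maximalRealSubfield L)) L (IsCMField.complexConj L) 3 H)))) := Subtype.borelSpace _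
  have hΨm : @Measurable (↥(Subgroup.centralizer ({γ₂} : Set (arch (↥(maximalRealSubfield L)) L (IsCMField.complexConj L) 3 H₂)))) (↥(Subgroup.centralizer ({(unitaryGroupOfFormCongrOfEq (conjMixed (↥(maximalRealSubfield L)) L (IsCMField.complexConj L)) S (archFormOf L 3 H) (archFormOf L 3 H₂) hS) γ₂} : Set (arch (↥(maximalRealSubfield L)) L (IsCMField.complexConj L) 3 H)))) _ _
      ⇑(subgroupCongrHomeomorph
        ((unitaryGroupOfFormCongrOfEq (conjMixed (↥(maximalRealSubfield L)) L (IsCMField.complexConj L)) S (archFormOf L 3 H) (archFormOf L 3 H₂) hS).toMulEquiv : arch (↥(maximalRealSubfield L)) L (IsCMField.complexConj L) 3 H₂ ≃* arch (↥(maximalRealSubfield L)) L (IsCMField.complexConj L) 3 H)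
        (Subgroup.centralizer ({γ₂} : Set (arch (↥(maximalRealSubfield L)) L (IsCMField.complexConj L) 3 H₂)))
        (Subgroup.centralizer ({(unitaryGroupOfFormCongrOfEq (conjMixed (↥(maximalRealSubfield L)) L (IsCMField.complexConj L)) S (archFormOf L 3 H) (archFormOf L 3 H₂) hS) γ₂} :
          Set (arch (↥(maximalRealSubfield L)) L (IsCMField.complexConj L) 3 H)))
        (forall_apply_mem_centralizer_singleton_iff_of_eq
          ((unitaryGroupOfFormCongrOfEq (conjMixed (↥(maximalRealSubfield L)) L (IsCMField.complexConj L)) S (archFormOf L 3 H) (archFormOf L 3 H₂) hS).toMulEquiv : arch (↥(maximalRealSubfield L)) L (IsCMField.complexConj L) 3 H₂ ≃* arch (↥(maximalRealSubfield L)) L (IsCMField.complexConj L) 3 H) rfl)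
        (unitaryGroupOfFormCongrOfEq (conjMixed (↥(maximalRealSubfield L)) L (IsCMField.complexConj L)) S (archFormOf L 3 H) (archFormOf L 3 H₂) hS).continuous
        (unitaryGroupOfFormCongrOfEq (conjMixed (↥(maximalRealSubfield L)) L (IsCMField.complexConj L)) S (archFormOf L 3 H) (archFormOf L 3 H₂) hS).symm.continuous) :=
    @Homeomorph.measurable (↥(Subgroup.centralizer ({γ₂} : Set (arch (↥(maximalRealSubfield L)) L (IsCMField.complexConj L) 3 H₂)))) (↥(Subgroup.centralizer ({(unitaryGroupOfFormCongrOfEq (conjMixed (↥(maximalRealSubfield L)) L (IsCMField.complexConj L)) S (archFormOf L 3 H) (archFormOf L 3 H₂) hS) γ₂} : Set (arch (↥(maximalRealSubfield L)) L (IsCMField.complexConj L) 3 H)))) _ _ iO2 _ _ iB1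
      ((subgroupCongrHomeomorph
        ((unitaryGroupOfFormCongrOfEq (conjMixed (↥(maximalRealSubfield L)) L (IsCMField.complexConj L)) S (archFormOf L 3 H) (archFormOf L 3 H₂) hS).toMulEquiv : arch (↥(maximalRealSubfield L)) L (IsCMField.complexConj L) 3 H₂ ≃* arch (↥(maximalRealSubfield L)) L (IsCMField.complexConj L) 3 H)
        (Subgroup.centralizer ({γ₂} : Set (arch (↥(maximalRealSubfield L)) L (IsCMField.complexConj L) 3 H₂)))
        (Subgroup.centralizer ({(unitaryGroupOfFormCongrOfEq (conjMixed (↥(maximalRealSubfield L)) L (IsCMField.complexConj L)) S (archFormOf L 3 H) (archFormOf L 3 H₂) hS) γ₂} :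
          Set (arch (↥(maximalRealSubfield L)) L (IsCMField.complexConj L) 3 H)))
        (forall_apply_mem_centralizer_singleton_iff_of_eq
          ((unitaryGroupOfFormCongrOfEq (conjMixed (↥(maximalRealSubfield L)) L (IsCMField.complexConj L)) S (archFormOf L 3 H) (archFormOf L 3 H₂) hS).toMulEquiv : arch (↥(maximalRealSubfield L)) L (IsCMField.complexConj L) 3 H₂ ≃* arch (↥(maximalRealSubfield L)) L (IsCMField.complexConj L) 3 H) rfl)
        (unitaryGroupOfFormCongrOfEq (conjMixed (↥(maximalRealSubfield L)) L (IsCMField.complexConj L)) S (archFormOf L 3 H) (archFormOf L 3 H₂) hS).continuous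
        (unitaryGroupOfFormCongrOfEq (conjMixed (↥(maximalRealSubfield L)) L (IsCMField.complexConj L)) S (archFormOf L 3 H) (archFormOf L 3 H₂) hS).symm.continuous) : ↥(Subgroup.centralizer ({γ₂} : Set (arch (↥(maximalRealSubfield L)) L (IsCMField.complexConj L) 3 H₂))) ≃ₜ ↥(Subgroup.centralizer ({(unitaryGroupOfFormCongrOfEq (conjMixed (↥(maximalRealSubfield L)) L (IsCMField.complexConj L)) S (archFormOf L 3 H) (archFormOf L 3 H₂) hS) γ₂} : Set (arch (↥(maximalRealSubfield L)) L (IsCMField.complexConj L) 3 H))))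
  rw [Measure.map_map hΨm hmeas₂]
  congr 1
  funext u
  apply Subtype.ext
  rw [Function.comp_apply, coe_subgroupCongrHomeomorph_apply]
  apply Subtype.ext
  show (((unitaryGroupOfFormCongrOfEq (conjMixed (↥(maximalRealSubfield L)) L (IsCMField.complexConj L)) S (archFormOf L 3 H) (archFormOf L 3 H₂) hS) (archFrameEmbedding (N₁ := 2) (N₂ := 1) T h₂.formCongr_eq u) : arch (↥(maximalRealSubfield L)) L (IsCMField.complexConj L) 3 H) : GL (Fin 3) (mixedSpace L)) =
    ((archFrameEmbedding (N₁ := 2) (N₂ := 1) (S * T) h₁.formCongr_eq u : arch (↥(maximalRealSubfield L)) L (IsCMField.complexConj L) 3 H) : GL (Fin 3) (mixedSpace L))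
  rw [coe_unitaryGroupOfFormCongrOfEq_apply, coe_archFrameEmbedding, coe_archFrameEmbedding, mul_inv_rev]
  simp only [mul_assoc]

end Congr

end UnitaryArchTopForm

end Literature.NumberTheory.Weil1964

end
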